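import Literature.NumberTheory.Transcendental.KaehlerHodgePreHilbert
import Literature.NumberTheory.Transcendental.L2HodgeTheoryAddLeftProofs
import Literature.NumberTheory.Transcendental.FormIntegrationNonnegProofs
import Literature.NumberTheory.Transcendental.FormIntegrationAddProofs
import Literature.NumberTheory.Transcendental.FormIntegrationBridgeProofs
import Literature.Geometry.Kaehler.ManifoldFormsFunSmulProofs
import HarnessLib

/-!
# Multiplication by a function bounded by `1` contracts the `L²` norm (Warner 6.33)

F. W. Warner, GTM 94 (1983), 6.33 uses `‖φ_j α_n‖ ≤ const ‖α_n‖` for the functions `φ_j` of a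
partition of unity. We prove the sharp elementary form: for a smooth real function `ρ` with
`|ρ| ≤ 1` and a smooth form `α` on a compact oriented Riemannian manifold,
`‖ρ α‖_{L²} ≤ ‖α‖_{L²}` — real forms (`MForm.l2Inner_fun_smul_self_le`) and complex forms in the
pre-Hilbert space `A^k(M; ℂ)` (`CL2SmoothForms.norm_mk_fun_smul_le`). Ingredients: the pointwise
identity `⟪ρα, ρα⟫_x = ρ(x)² ⟪α, α⟫_x`, additivity of the integral on smooth top forms and
non-negativity of `∫ f vol` for `f ≥ 0`.

## References

* F. W. Warner, GTM 94 (1983), 6.33. [WarnerGTM94]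
-/

noncomputable section

open scoped Manifold ContDiff
open Bundle Module
open Literature.NumberTheory.Transcendental

namespace Literature.Geometry.Kaehler

section Real

variable {E : Type*} [NormedAddCommGroup E] [NormedSpace ℝ E] [FiniteDimensional ℝ E]
  {n : ℕ} [Fact (finrank ℝ E = n)] [MeasurableSpace E] [BorelSpace E]
  {H : Type*} [TopologicalSpace H] {I : ModelWithCorners ℝ E H}
  {M : Type*} [TopologicalSpace M] [ChartedSpace H M] [T2Space M] [CompactSpace M]
  [IsManifold I ∞ M] [RiemannianBundle (fun x : M ↦ TangentSpace I x)]
  [IsContMDiffRiemannianBundle I ∞ E (fun x : M ↦ TangentSpace I x)]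
  (o : (x : M) → Orientation ℝ (TangentSpace I x) (Fin n)) {k : ℕ}

omit [MeasurableSpace E] [BorelSpace E] [T2Space M] [CompactSpace M] [IsManifold I ∞ M]
  [IsContMDiffRiemannianBundle I ∞ E (fun x : M ↦ TangentSpace I x)] in
/-- `⟪ρα, ρα⟫_x = ρ(x)² ⟪α, α⟫_x`. [folklore] -/
theorem MForm.inner_fun_smul_self (ρ : M → ℝ) (α : MForm I M ℝ k) (x : M) :
    MForm.inner n (ρ • α) (ρ • α) x = ρ x ^ 2 * MForm.inner n α α x := by
  simp only [MForm.inner, Pi.smul_apply', map_smul, LinearMap.smul_apply, smul_eq_mul]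
  ring

/-- **`‖ρ α‖²_{L²} ≤ ‖α‖²_{L²}` for `|ρ| ≤ 1`** (real smooth forms, compact oriented Riemannian
manifold with smooth volume form). [cite: WarnerGTM94, 6.33] -/
theorem MForm.l2Inner_fun_smul_self_le (ho : IsSmoothForm (riemannianVolumeForm o)) {ρ : M → ℝ}
    (hρ : ContMDiff I 𝓘(ℝ) ∞ ρ) (hρ1 : ∀ x, |ρ x| ≤ 1) {α : MForm I M ℝ k} (hα : IsSmoothForm α) :
    MForm.l2Inner o (ρ • α) (ρ • α) ≤ MForm.l2Inner o α α := by
  haveI : IsContinuousRiemannianBundle E (fun x : M ↦ TangentSpace I x) :=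
    isContinuousRiemannianBundle_of_isContMDiffRiemannianBundle I ∞
  have hc : IsContinuousOrientation o := isContinuousOrientation_of_isSmoothForm_riemannianVolumeForm_holds o ho
  have hρα : IsSmoothForm (ρ • α) := hα.fun_smul' hρ
  -- the three top forms
  set A : MForm I M ℝ n := fun x ↦ MForm.inner n α α x • riemannianVolumeForm o x with hA
  set B : MForm I M ℝ n := fun x ↦ MForm.inner n (ρ • α) (ρ • α) x • riemannianVolumeForm o x with hB
  set D : MForm I M ℝ n := fun x ↦ ((1 - ρ x ^ 2) * MForm.inner n α α x) • riemannianVolumeForm o x with hD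
  have hAs : IsSmoothForm A := hα.inner_smul_riemannianVolumeForm hα o ho
  have hBs : IsSmoothForm B := hρα.inner_smul_riemannianVolumeForm hρα o ho
  have hABD : A = B + D := by
    funext x
    simp only [hA, hB, hD, Pi.add_apply, ← add_smul]
    congr 1
    rw [MForm.inner_fun_smul_self]
    ring
  have hDs : IsSmoothForm D := by
    have : D = A + (-1 : ℝ) • B := by
      rw [hABD]; funext x; simp only [Pi.add_apply, neg_one_smul, Pi.neg_apply]; abel
    rw [this]
    exact hAs.add (hBs.smul _)
  have hDn : 0 ≤ MForm.integral o D :=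
    integral_smul_riemannianVolumeForm_nonneg_holds o fun x ↦
      mul_nonneg (by nlinarith [abs_le.1 (hρ1 x), sq_abs (ρ x)]) (alternatingFormInner_self_nonneg k (α x))
  change MForm.integral o B ≤ MForm.integral o A
  rw [hABD, MForm.integral_add_holds o hc hBs hDs]
  linarith

end Real

section Complex

variable {E : Type*} [NormedAddCommGroup E] [NormedSpace ℂ E] [FiniteDimensional ℂ E]
  {n : ℕ} [Fact (finrank ℝ E = n)] [MeasurableSpace E] [BorelSpace E]
  {M : Type*} [TopologicalSpace M] [ChartedSpace E M] [T2Space M] [CompactSpace M]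
  [IsManifold 𝓘(ℝ, E) ∞ M] [RiemannianBundle (fun x : M ↦ TangentSpace 𝓘(ℝ, E) x)]
  [IsContMDiffRiemannianBundle 𝓘(ℝ, E) ∞ E (fun x : M ↦ TangentSpace 𝓘(ℝ, E) x)]
  (o : (x : M) → Orientation ℝ (TangentSpace 𝓘(ℝ, E) x) (Fin n)) {k : ℕ}
  [Fact (IsSmoothForm (riemannianVolumeForm o))]

omit [FiniteDimensional ℂ E] [MeasurableSpace E] [BorelSpace E] [T2Space M] [CompactSpace M] [IsManifold 𝓘(ℝ, E) ∞ M]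
  [RiemannianBundle (fun x : M ↦ TangentSpace 𝓘(ℝ, E) x)]
  [IsContMDiffRiemannianBundle 𝓘(ℝ, E) ∞ E (fun x : M ↦ TangentSpace 𝓘(ℝ, E) x)] in
/-- Real and imaginary parts of a real function multiple. [folklore] -/
theorem MForm.re_fun_smul (ρ : M → ℝ) (α : MForm 𝓘(ℝ, E) M ℂ k) : (ρ • α).re = ρ • α.re ∧ (ρ • α).im = ρ • α.im := by
  constructor
  · funext x; ext v
    simp only [MForm.re_apply, Pi.smul_apply', ContinuousAlternatingMap.smul_apply, Complex.real_smul,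
      Complex.mul_re, Complex.ofReal_re, Complex.ofReal_im, zero_mul, sub_zero, smul_eq_mul]
  · funext x; ext v
    simp only [MForm.im_apply, Pi.smul_apply', ContinuousAlternatingMap.smul_apply, Complex.real_smul,
      Complex.mul_im, Complex.ofReal_re, Complex.ofReal_im, zero_mul, add_zero, smul_eq_mul]

/-- **`‖ρ α‖_{L²} ≤ ‖α‖_{L²}` for `|ρ| ≤ 1` in `A^k(M; ℂ)`** (Warner 6.33's
`‖φ_j α‖ ≤ const ‖α‖` for partition-of-unity functions). [cite: WarnerGTM94, 6.33] -/
theorem CL2SmoothForms.norm_mk_fun_smul_le {ρ : M → ℝ} (hρ : ContMDiff 𝓘(ℝ, E) 𝓘(ℝ) ∞ ρ)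
    (hρ1 : ∀ x, |ρ x| ≤ 1) {α : MForm 𝓘(ℝ, E) M ℂ k} (hα : IsSmoothForm α) :
    ‖CL2SmoothForms.mk o (ρ • α) (hα.fun_smul' hρ)‖ ≤ ‖CL2SmoothForms.mk o α hα‖ := by
  have ho : IsSmoothForm (riemannianVolumeForm o) := Fact.out
  refine le_of_pow_le_pow_left₀ two_ne_zero (norm_nonneg _) ?_
  rw [CL2SmoothForms.norm_mk_sq_eq_add, CL2SmoothForms.norm_mk_sq_eq_add, (MForm.re_fun_smul ρ α).1,
    (MForm.re_fun_smul ρ α).2]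
  exact add_le_add (MForm.l2Inner_fun_smul_self_le o ho hρ hρ1 hα.re)
    (MForm.l2Inner_fun_smul_self_le o ho hρ hρ1 hα.im)
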